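import Summits.FinalStateConjecture.FinalStateConjecture.Theorems.EIHFluxBalanceInertialRecessionChargeKinematicsSingleton

/-!
# Route EIHFluxBalance — `InertialRecession`, line `old-light-leaves-the-cone`: charge kinematics,
# XXVII (general N: the rule window law)

Helper file for the crux `stmt-FinalStateConjecture-10166`
(`Summit.FinalStateConjecture.FinalStateConjecture.Theses.EIHFluxBalance.InertialRecession`), second line
lead, endgame stub `stub_expandingChargeKinematics` (S4: abstract quasi-conserved window charges with the
slack-form window law and the single-hole identification ⇒ Cesàro velocities of the painted centres).
THE ESCAPE SERIES: the endgame for `N = 3` (Case A all-pairs freezing is `ChargeKinematicsAllPairs*`;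
Case B, the escape of a fast hole from a velocity-tight pair, is this series; the assembly is
`ChargeKinematicsThree`).

XXVII — GENERAL N: THE RULE WINDOW LAW (`rule_window_law`, `rule_window_error_le`): the cluster window law
along clearance functions that are only bounded below (`ψ ≥ ψ₀`), with identification errors
`O(|ζ| + 1/ψ₀ + 1/D)` — the package source for `anchor_increment_via_rules`.

Every statement is Mathlib-only real analysis over the stub's verbatim hypotheses ([folklore]); the abstract
charge `P` is arbitrary (adversarial), constrained only by the window law and the identification.
-/

set_option linter.dupNamespace false

noncomputable section

open Filter Set Metric Real
open scoped Topology

namespace Summit.FinalStateConjecture.FinalStateConjecture.Theorems.ChargeKinematics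

open Literature.Geometry.Lorentzian

/-! ## The rule window law -/

section RuleWindow

open MeasureTheory intervalIntegral

variable {N : ℕ} {M : Fin N → ℝ} {ξ v : Fin N → ℝ → E3} {κ : ℝ} {P : ℝ → E3 → ℝ → Fin 4 → ℝ}

/-- Error bookkeeping of the rule window law (pure arithmetic): with `R ≥ ψ₀/2`, `ρ ≥ min(D/3, ψ₀/8)`,
the additivity error plus `n` single-identification errors is at most
`(1 + n)|ζ| + |C'|·(2(1 + 8n)/ψ₀ + 6n/D)`. [folklore] -/
theorem rule_window_error_le {C' ζ ψ₀ D ρ R n : ℝ} (hψ₀ : 0 < ψ₀) (hD : 0 < D) (hρ : 0 < ρ) (hR : ψ₀ / 2 ≤ R)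
    (hρge : min (D / 3) (ψ₀ / 8) ≤ ρ) (hn : 0 ≤ n) :
    C' * (R⁻¹ + n * ρ⁻¹) + ζ + n * (ζ + C' / ρ) ≤ (1 + n) * |ζ| + |C'| * (2 * (1 + 8 * n) / ψ₀ + 6 * n / D) := by
  have hinvρ : ρ⁻¹ ≤ 3 / D + 8 / ψ₀ := by
    have hmpos : 0 < min (D / 3) (ψ₀ / 8) := lt_min (by linarith) (by linarith)
    calc ρ⁻¹ ≤ (min (D / 3) (ψ₀ / 8))⁻¹ := inv_anti₀ hmpos hρge
      _ ≤ (D / 3)⁻¹ + (ψ₀ / 8)⁻¹ := by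
          rcases min_choice (D / 3) (ψ₀ / 8) with h | h <;> rw [h]
          · linarith [inv_nonneg.mpr (by linarith : (0:ℝ) ≤ ψ₀ / 8)]
          · linarith [inv_nonneg.mpr (by linarith : (0:ℝ) ≤ D / 3)]
      _ = 3 / D + 8 / ψ₀ := by rw [inv_div, inv_div]
  have hinvR : R⁻¹ ≤ 2 / ψ₀ := by
    calc R⁻¹ ≤ (ψ₀ / 2)⁻¹ := inv_anti₀ (by linarith) hR
      _ = 2 / ψ₀ := inv_div _ _
  have hRpos : 0 < R := by linarith
  -- bound `C'` by `|C'|` on nonnegative multipliers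
  have h1 : C' * (R⁻¹ + n * ρ⁻¹) ≤ |C'| * (2 / ψ₀ + n * (3 / D + 8 / ψ₀)) := by
    have hnn : 0 ≤ R⁻¹ + n * ρ⁻¹ := by positivity
    calc C' * (R⁻¹ + n * ρ⁻¹) ≤ |C'| * (R⁻¹ + n * ρ⁻¹) := mul_le_mul_of_nonneg_right (le_abs_self C') hnn
      _ ≤ |C'| * (2 / ψ₀ + n * (3 / D + 8 / ψ₀)) :=
          mul_le_mul_of_nonneg_left (add_le_add hinvR (mul_le_mul_of_nonneg_left hinvρ hn)) (abs_nonneg C')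
  have h2 : n * (ζ + C' / ρ) ≤ n * (|ζ| + |C'| * (3 / D + 8 / ψ₀)) := by
    refine mul_le_mul_of_nonneg_left ?_ hn
    have h3 : C' / ρ ≤ |C'| * ρ⁻¹ := by
      rw [div_eq_mul_inv]; exact mul_le_mul_of_nonneg_right (le_abs_self C') (inv_pos.mpr hρ).le
    have h4 := mul_le_mul_of_nonneg_left hinvρ (abs_nonneg C')
    linarith only [h3, h4, le_abs_self ζ]
  have hid : |C'| * (2 / ψ₀ + n * (3 / D + 8 / ψ₀)) + |ζ| + n * (|ζ| + |C'| * (3 / D + 8 / ψ₀)) =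
      (1 + n) * |ζ| + |C'| * (2 * (1 + 8 * n) / ψ₀ + 6 * n / D) := by ring
  linarith only [h1, h2, hid, le_abs_self ζ]

/-- **THE RULE WINDOW LAW.** The cluster window law along a clearance function `ψ` that is only known to
be BOUNDED BELOW by a constant `ψ₀` (not to grow): for a finite cluster `U` and an anchor `a` (normally `a ∈ U`), any late interval,
any `4`-Lipschitz `ψ ≥ ψ₀ ≥ ψ*` with members within `ψ/4` (and `c₂s/2`) and all other holes beyond `ψ`,
the window `(ξ_a, min(ψ/2, c₂s))` obeys the law with ONE slack `|η(s₁)|`, and at every time of the interval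
its charge is the kinematic cluster charge up to
`(1 + |U|)|ζ(s)| + |C'|·(2(1 + 8|U|)/ψ₀ + 6|U|/D(s))` (`D` = least pairwise distance; member spheres
`min(D/3, R/4)`, identification used pointwise). Errors are small by LATENESS (`ζ`, `D`) and by the
CHOICE OF `ψ₀` (then of the floor `m₀ ≥ C_n ψ₀/2` in the rule mechanism). [folklore] -/
theorem rule_window_law (hκ0 : 0 < κ) (hκ1 : κ < 1)
    (hξ : ∀ i, ContDiff ℝ ((⊤ : ℕ∞) : WithTop ℕ∞) (ξ i))
    (hcone : ∀ i, ∀ᶠ t in atTop, ‖ξ i t‖ ≤ κ ^ 2 * t)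
    (hsep : ∀ i j, i ≠ j → Tendsto (fun t ↦ ‖ξ i t - ξ j t‖) atTop atTop)
    (hk : ∃ k : ℝ, 0 ≤ k ∧ k < 1 ∧ ∀ i, ∀ᶠ t in atTop, ‖v i t‖ ≤ k)
    (hslave : ∀ i, Tendsto (fun t ↦ deriv (ξ i) t - v i t) atTop (𝓝 0))
    (hW : ∀ δ : ℝ, 0 < δ → δ < 1 → ∃ (C R₀ T : ℝ) (η : ℝ → ℝ), Tendsto η atTop (𝓝 0) ∧ ∀ (t₁ t₂ : ℝ) (c : ℝ → E3) (R : ℝ → ℝ), T ≤ t₁ → t₁ ≤ t₂ → (∀ s ∈ Set.Icc t₁ t₂, ∀ s' ∈ Set.Icc t₁ t₂, ‖c s - c s'‖ ≤ 2 * |s - s'| ∧ |R s - R s'| ≤ 2 * |s - s'|) → (∀ s ∈ Set.Icc t₁ t₂, (R₀ ≤ R s ∧ ‖c s‖ + R s ≤ (κ + κ ^ 2) / 2 * s ∧ ∀ j, ‖ξ j s - c s‖ ≤ (1 - δ) * R s ∨ (1 + δ) * R s ≤ ‖ξ j s - c s‖)) → ∀ μ : Fin 4, |P t₂ (c t₂)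 (R t₂) μ - P t₁ (c t₁) (R t₁) μ| ≤ C * (∫ s in t₁..t₂, ((R s) ^ 2)⁻¹ + ((R s) ^ (7 / 4 : ℝ))⁻¹) + η t₁)
    (hI : ∃ (C R₀ T : ℝ) (ζ : ℝ → ℝ), Tendsto ζ atTop (𝓝 0) ∧ (∀ (t : ℝ) (i : Fin N) (R : ℝ), T ≤ t → R₀ ≤ R → ‖ξ i t‖ + R ≤ (κ + κ ^ 2) / 2 * t → (∀ j, j ≠ i → 3 * R ≤ ‖ξ i t - ξ j t‖) → |P t (ξ i t) R 0 - M i * (√(1 - ‖v i t‖ ^ 2))⁻¹| ≤ ζ t + C / R ∧ ∀ k : Fin 3, |P t (ξ i t) R k.succ - M i * (√(1 - ‖v i t‖ ^ 2))⁻¹ * v i t k| ≤ ζ t + C / R) ∧ (∀ (t : ℝ) (c : E3) (R : ℝ) (A : Finset (Fin N)) (ρ : Fin N → ℝ), T ≤ t → R₀ ≤ R → ‖c‖ + R ≤ (κ + κ ^ 2) / 2 * t → (∀ j ∈ A, ‖ξ j t - c‖ ≤ R / 2) → (∀ j ∉ A, 2 * R ≤ ‖ξ j t - c‖) → (∀ j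 ∈ A, R₀ ≤ ρ j ∧ ρ j ≤ R / 4 ∧ ∀ j', j' ≠ j → 3 * ρ j ≤ ‖ξ j t - ξ j' t‖) → ∀ μ : Fin 4, |P t c R μ - ∑ j ∈ A, P t (ξ j t) (ρ j) μ| ≤ C * (R⁻¹ + ∑ j ∈ A, (ρ j)⁻¹) + ζ t))
    (U : Finset (Fin N)) (a : Fin N) (hpair : ∃ p : Fin N × Fin N, p.1 ≠ p.2) {c₂ : ℝ}
    (hc₂ : 0 < c₂) (hc₂κ : c₂ ≤ (κ - κ ^ 2) / 2) (hc₂1 : c₂ ≤ 1) :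
    ∃ (Cw C' ψst Tw : ℝ) (ζ D : ℝ → ℝ), 0 ≤ Cw ∧ 0 ≤ C' ∧ 0 < ψst ∧ Tendsto ζ atTop (𝓝 0) ∧
      Tendsto D atTop atTop ∧ (∀ t, Tw ≤ t → 0 ≤ ζ t ∧ 1 ≤ D t) ∧
      ∃ ηa : ℝ → ℝ, Tendsto ηa atTop (𝓝 0) ∧ (∀ t, 0 ≤ ηa t) ∧
      ∀ (ψ₀ : ℝ), ψst ≤ ψ₀ → ∀ (s₁ s₂ : ℝ) (ψ : ℝ → ℝ), Tw ≤ s₁ → ψ₀ ≤ c₂ * s₁ → s₁ ≤ s₂ →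
        (∀ s ∈ Set.Icc s₁ s₂, ∀ s' ∈ Set.Icc s₁ s₂, |ψ s - ψ s'| ≤ 4 * |s - s'|) →
        (∀ s ∈ Set.Icc s₁ s₂, ψ₀ ≤ ψ s ∧ (∀ j ∈ U, 4 * ‖ξ a s - ξ j s‖ ≤ ψ s ∧ 2 * ‖ξ a s - ξ j s‖ ≤ c₂ * s) ∧
          ∀ l ∉ U, ψ s ≤ ‖ξ l s - ξ a s‖) →
        (∀ μ : Fin 4, |P s₂ (ξ a s₂) (min (ψ s₂ / 2) (c₂ * s₂)) μ -
            P s₁ (ξ a s₁) (min (ψ s₁ / 2) (c₂ * s₁)) μ| ≤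
          Cw * (∫ s in s₁..s₂, ((min (ψ s / 2) (c₂ * s)) ^ 2)⁻¹ +
            ((min (ψ s / 2) (c₂ * s)) ^ (7 / 4 : ℝ))⁻¹) + ηa s₁) ∧
        (∀ s ∈ Set.Icc s₁ s₂,
          |P s (ξ a s) (min (ψ s / 2) (c₂ * s)) 0 - ∑ j ∈ U, M j * (√(1 - ‖v j s‖ ^ 2))⁻¹| ≤
              (1 + U.card) * ζ s + C' * (2 * (1 + 8 * U.card) / ψ₀ + 6 * U.card / D s) ∧
          ∀ k' : Fin 3, |P s (ξ a s) (min (ψ s / 2) (c₂ * s)) k'.succ -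
              ∑ j ∈ U, M j * (√(1 - ‖v j s‖ ^ 2))⁻¹ * v j s k'| ≤
              (1 + U.card) * ζ s + C' * (2 * (1 + 8 * U.card) / ψ₀ + 6 * U.card / D s)) := by
  classical
  obtain ⟨C, R₀, T, η, hη, hlaw⟩ := hW (1 / 2) (by norm_num) (by norm_num)
  obtain ⟨C', R₀', T', ζ, hζ, hid1, hadd⟩ := id hI
  obtain ⟨k, hk0, hk1, hvk⟩ := id hk
  clear hW hI
  have hκκ : 0 < κ - κ ^ 2 := by nlinarith
  have hd : ∀ i, Differentiable ℝ (ξ i) := fun i ↦ (contDiff_infty_iff_deriv.mp (hξ i)).1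
  -- Lipschitz thresholds and the least pairwise distance `D`
  choose TLi hTLi using fun i ↦ exists_forall_norm_sub_le_two_mul (hd i) (hslave i) hk1.le (hvk i)
  haveI : Nonempty (Fin N) := ⟨a⟩
  obtain ⟨TL, hTLge, hTL0⟩ : ∃ TL : ℝ, (∀ i, TLi i ≤ TL) ∧ 0 ≤ TL :=
    ⟨Finset.univ.sup' Finset.univ_nonempty TLi ⊔ 0,
      fun i ↦ (Finset.le_sup' TLi (Finset.mem_univ i)).trans le_sup_left, le_sup_right⟩
  obtain ⟨D, hDle, hDinf⟩ : ∃ D : ℝ → ℝ, (∀ s (i j : Fin N), i ≠ j → D s ≤ ‖ξ i s - ξ j s‖) ∧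
      Tendsto D atTop atTop := by
    let S : Finset (Fin N × Fin N) := Finset.univ.filter fun p ↦ p.1 ≠ p.2
    have hmem : ∀ {i j : Fin N}, i ≠ j → (i, j) ∈ S := fun hij ↦
      Finset.mem_filter.mpr ⟨Finset.mem_univ _, hij⟩
    have hSne : S.Nonempty := by obtain ⟨p, hp⟩ := hpair; exact ⟨(p.1, p.2), hmem hp⟩
    refine ⟨fun s ↦ S.inf' hSne fun p ↦ ‖ξ p.1 s - ξ p.2 s‖, fun s i j hij ↦ ?_, ?_⟩
    · exact Finset.inf'_le (fun p : Fin N × Fin N ↦ ‖ξ p.1 s - ξ p.2 s‖) (hmem hij)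
    · refine tendsto_inf'_atTop hSne fun p hp ↦ hsep p.1 p.2 ?_
      exact (Finset.mem_filter.mp hp).2
  -- constants and threshold
  set ψst : ℝ := 8 * (max (max R₀ R₀') 1) with hψstdef
  have hψst : 0 < ψst := by positivity
  have hDev : ∀ᶠ s in atTop, max (3 * R₀') 1 ≤ D s := hDinf.eventually_ge_atTop _
  have hζev : ∀ᶠ s in atTop, 0 ≤ |ζ s| := Eventually.of_forall fun s ↦ abs_nonneg _
  obtain ⟨Tw, hTw⟩ := eventually_atTop.mp ((hcone a).and (hDev.and ((eventually_ge_atTop T).and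
    ((eventually_ge_atTop T').and ((eventually_ge_atTop TL).and (eventually_ge_atTop (0 : ℝ)))))))
  refine ⟨|C|, |C'|, ψst, Tw, fun s ↦ |ζ s|, D, abs_nonneg C, abs_nonneg C', hψst, ?_, hDinf, ?_,
    fun s ↦ |η s|, ?_, fun s ↦ abs_nonneg _, ?_⟩
  · simpa using hζ.abs
  · intro t ht
    obtain ⟨-, hDt, -⟩ := hTw t ht
    exact ⟨abs_nonneg _, (le_max_right _ _).trans hDt⟩
  · simpa using hη.abs
  intro ψ₀ hψ₀ s₁ s₂ ψ hs₁ hcs₁ h12 hψlip hgeom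
  -- facts along the interval
  have hfacts : ∀ s ∈ Set.Icc s₁ s₂, ‖ξ a s‖ ≤ κ ^ 2 * s ∧ max (3 * R₀') 1 ≤ D s ∧ T ≤ s ∧ T' ≤ s ∧
      TL ≤ s ∧ 0 ≤ s := fun s hs ↦ hTw s (hs₁.trans hs.1)
  have hthr : max (max R₀ R₀') 1 ≤ ψ₀ / 8 := by
    rw [le_div_iff₀ (by norm_num : (0:ℝ) < 8)]; simp only [hψstdef] at hψ₀; linarith
  -- the radius dominates `ψ₀/2`
  have hRge : ∀ s ∈ Set.Icc s₁ s₂, ψ₀ / 2 ≤ min (ψ s / 2) (c₂ * s) := by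
    intro s hs
    obtain ⟨hψ0, -, -⟩ := hgeom s hs
    refine le_min (by linarith) ?_
    have hs0 : s₁ ≤ s := hs.1
    nlinarith [hc₂]
  have hψ₀pos : 0 < ψ₀ := hψst.trans_le hψ₀
  have hR1 : ∀ s ∈ Set.Icc s₁ s₂, 1 ≤ min (ψ s / 2) (c₂ * s) := fun s hs ↦ by
    have := hRge s hs; have := (le_max_right _ _).trans hthr; linarith
  have hRR₀ : ∀ s ∈ Set.Icc s₁ s₂, max R₀ R₀' ≤ min (ψ s / 2) (c₂ * s) := fun s hs ↦ by
    have := hRge s hs; have := (le_max_left _ _).trans hthr; linarith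
  refine ⟨fun μ ↦ ?_, fun s hs ↦ ?_⟩
  · -- the law along the path `(ξ a, R)`
    obtain ⟨-, -, hT1, -, hTL1, -⟩ := hfacts s₁ ⟨le_rfl, h12⟩
    have key := hlaw s₁ s₂ (fun s ↦ ξ a s) (fun s ↦ min (ψ s / 2) (c₂ * s)) hT1 h12 ?_ ?_ μ
    · refine key.trans ?_
      have hnn : 0 ≤ ∫ s in s₁..s₂, (((min (ψ s / 2) (c₂ * s)) ^ 2)⁻¹ +
          ((min (ψ s / 2) (c₂ * s)) ^ (7 / 4 : ℝ))⁻¹) := by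
        apply intervalIntegral.integral_nonneg h12
        intro s hs
        have : 0 < min (ψ s / 2) (c₂ * s) := one_pos.trans_le (hR1 s hs)
        positivity
      have hC : C * (∫ s in s₁..s₂, (((min (ψ s / 2) (c₂ * s)) ^ 2)⁻¹ +
          ((min (ψ s / 2) (c₂ * s)) ^ (7 / 4 : ℝ))⁻¹)) ≤
          |C| * ∫ s in s₁..s₂, (((min (ψ s / 2) (c₂ * s)) ^ 2)⁻¹ +
            ((min (ψ s / 2) (c₂ * s)) ^ (7 / 4 : ℝ))⁻¹) :=
        mul_le_mul_of_nonneg_right (le_abs_self C) hnn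
      linarith only [hC, le_abs_self (η s₁)]
    · intro s hs s' hs'
      refine ⟨hTLi a s s' ((hTLge a).trans (hTL1.trans hs.1)) ((hTLge a).trans (hTL1.trans hs'.1)), ?_⟩
      refine (abs_min_sub_min_le_max _ _ _ _).trans (max_le ?_ ?_)
      · rw [← sub_div, abs_div, abs_of_pos (by norm_num : (0 : ℝ) < 2),
          div_le_iff₀ (by norm_num : (0 : ℝ) < 2)]
        have := hψlip s hs s' hs'
        linarith [abs_nonneg (s - s')]
      · rw [← mul_sub, abs_mul, abs_of_pos hc₂]
        exact mul_le_mul_of_nonneg_right (by linarith) (abs_nonneg _)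
    · intro s hs
      obtain ⟨hcone_s, -, -, -, -, hs0⟩ := hfacts s hs
      obtain ⟨hψ0, hmem, hoth⟩ := hgeom s hs
      refine ⟨(le_max_left _ _).trans (hRR₀ s hs), ?_, fun j ↦ ?_⟩
      · have : min (ψ s / 2) (c₂ * s) ≤ c₂ * s := min_le_right _ _
        nlinarith
      · by_cases hjU : j ∈ U
        · left
          obtain ⟨h4, h2⟩ := hmem j hjU
          rw [norm_sub_rev]
          have : ‖ξ a s - ξ j s‖ ≤ min (ψ s / 2) (c₂ * s) / 2 := by
            rw [le_div_iff₀ (by norm_num : (0 : ℝ) < 2)]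
            exact le_min (by linarith) (by linarith)
          linarith
        · right
          have h3 := hoth j hjU
          have : min (ψ s / 2) (c₂ * s) ≤ ψ s / 2 := min_le_left _ _
          linarith [hψ₀pos.le]
  · -- identification at `s`
    obtain ⟨hcone_s, hDs, -, hT's, hTLs, hs0⟩ := hfacts s hs
    obtain ⟨hψ0, hmem, hoth⟩ := hgeom s hs
    have hR1s := hR1 s hs
    have hRpos : 0 < min (ψ s / 2) (c₂ * s) := one_pos.trans_le hR1s
    have hRge' := hRge s hs
    -- member spheres `ρ = min(D/3, R/4)`
    obtain ⟨ρ, hρdef⟩ : ∃ x : ℝ, x = min (D s / 3) (min (ψ s / 2) (c₂ * s) / 4) := ⟨_, rfl⟩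
    have hρD : ρ ≤ D s / 3 := by rw [hρdef]; exact min_le_left _ _
    have hρR : ρ ≤ min (ψ s / 2) (c₂ * s) / 4 := by rw [hρdef]; exact min_le_right _ _
    have hD1 : 1 ≤ D s := (le_max_right _ _).trans hDs
    have hρpos : 0 < ρ := by
      rw [hρdef]; exact lt_min (by linarith only [hD1]) (by linarith only [hRpos])
    have hρR₀' : R₀' ≤ ρ := by
      rw [hρdef]
      refine le_min ?_ ?_
      · have := (le_max_left _ _).trans hDs; linarith only [this]
      · have := (le_max_right R₀ R₀').trans ((le_max_left _ _).trans hthr); linarith only [this, hRge']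
    have hρsep : ∀ j (j' : Fin N), j' ≠ j → 3 * ρ ≤ ‖ξ j s - ξ j' s‖ := fun j j' hj' ↦ by
      have := hDle s j j' hj'.symm; linarith only [this, hρD]
    have hadd' := hadd s (ξ a s) (min (ψ s / 2) (c₂ * s)) U (fun _ ↦ ρ) hT's
      ((le_max_right _ _).trans (hRR₀ s hs))
      (by have : min (ψ s / 2) (c₂ * s) ≤ c₂ * s := min_le_right _ _; nlinarith) ?_ ?_ ?_
    rotate_left
    · intro j hj
      obtain ⟨h4, h2⟩ := hmem j hj
      rw [norm_sub_rev]
      have : ‖ξ a s - ξ j s‖ ≤ min (ψ s / 2) (c₂ * s) / 2 := by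
        rw [le_div_iff₀ (by norm_num : (0 : ℝ) < 2)]
        exact le_min (by linarith) (by linarith)
      exact this
    · intro j hj
      have h3 := hoth j hj
      have : min (ψ s / 2) (c₂ * s) ≤ ψ s / 2 := min_le_left _ _
      linarith
    · intro j _
      exact ⟨hρR₀', hρR, fun j' hj' ↦ hρsep j j' hj'⟩
    -- single identifications at radius `ρ`, pointwise from `hI`
    have hsing : ∀ j ∈ U, |P s (ξ j s) ρ 0 - M j * (√(1 - ‖v j s‖ ^ 2))⁻¹| ≤ ζ s + C' / ρ ∧
        ∀ k' : Fin 3, |P s (ξ j s) ρ k'.succ - M j * (√(1 - ‖v j s‖ ^ 2))⁻¹ * v j s k'| ≤ ζ s + C' / ρ := by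
      intro j hj
      have hconej : ‖ξ j s‖ + ρ ≤ (κ + κ ^ 2) / 2 * s := by
        -- `‖ξ j‖ ≤ ‖ξ a‖ + ‖ξ a - ξ j‖ ≤ κ² s + c₂ s/2` and `ρ ≤ R/4 ≤ c₂ s/4`
        obtain ⟨-, h2⟩ := hmem j hj
        have h1 : ‖ξ j s‖ ≤ ‖ξ a s‖ + ‖ξ a s - ξ j s‖ := by
          have := norm_sub_norm_le (ξ j s) (ξ a s)
          rw [norm_sub_rev] at this; linarith
        have h3 : ρ ≤ c₂ * s / 4 := hρR.trans (by
          have := min_le_right (ψ s / 2) (c₂ * s); linarith)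
        nlinarith
      exact hid1 s j ρ hT's hρR₀' hconej (fun j' hj' ↦ hρsep j j' hj')
    -- error bookkeeping
    have hρge : min (D s / 3) (ψ₀ / 8) ≤ ρ := by
      rw [hρdef]
      exact min_le_min le_rfl (by linarith only [hRge'])
    have hcard : ∑ j ∈ U, ρ⁻¹ = U.card * ρ⁻¹ := by rw [Finset.sum_const, nsmul_eq_mul]
    have hcard' : ∑ j ∈ U, (ζ s + C' / ρ) = U.card * (ζ s + C' / ρ) := by rw [Finset.sum_const, nsmul_eq_mul]
    have harith := rule_window_error_le (C' := C') (ζ := ζ s) hψ₀pos (one_pos.trans_le hD1) hρpos hRge' hρge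
      (Nat.cast_nonneg U.card)
    have hsum0 : |∑ j ∈ U, P s (ξ j s) ρ 0 - ∑ j ∈ U, M j * (√(1 - ‖v j s‖ ^ 2))⁻¹| ≤ ∑ j ∈ U, (ζ s + C' / ρ) := by
      rw [← Finset.sum_sub_distrib]
      exact (Finset.abs_sum_le_sum_abs _ _).trans (Finset.sum_le_sum fun j hj ↦ (hsing j hj).1)
    have hsumk : ∀ k' : Fin 3, |∑ j ∈ U, P s (ξ j s) ρ k'.succ -
        ∑ j ∈ U, M j * (√(1 - ‖v j s‖ ^ 2))⁻¹ * v j s k'| ≤ ∑ j ∈ U, (ζ s + C' / ρ) := by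
      intro k'
      rw [← Finset.sum_sub_distrib]
      exact (Finset.abs_sum_le_sum_abs _ _).trans (Finset.sum_le_sum fun j hj ↦ (hsing j hj).2 k')
    constructor
    · have h1 := hadd' 0
      rw [hcard] at h1
      have h2 := hsum0
      rw [hcard'] at h2
      have := (abs_sub_le _ (∑ j ∈ U, P s (ξ j s) ρ 0) _).trans (add_le_add h1 h2)
      linarith only [this, harith]
    · intro k'
      have h1 := hadd' k'.succ
      rw [hcard] at h1
      have h2 := hsumk k'
      rw [hcard'] at h2
      have := (abs_sub_le _ (∑ j ∈ U, P s (ξ j s) ρ k'.succ) _).trans (add_le_add h1 h2)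
      linarith only [this, harith]

end RuleWindow

end Summit.FinalStateConjecture.FinalStateConjecture.Theorems.ChargeKinematics

namespace Summit.FinalStateConjecture.FinalStateConjecture.Theorems

/-- REGISTERED STUB `rule_window_law` of the crux item stmt-FinalStateConjecture-10166 (second line lead, line
`old-light-leaves-the-cone`, S4 escape series): the registered one-line signature verbatim, discharged by
`ChargeKinematics.rule_window_law`. [folklore] -/
theorem rule_window_law : open Literature.Geometry.Lorentzian Filter Topology MeasureTheory intervalIntegral in ∀ {N : ℕ} {M : Fin N → ℝ} {ξ v : Fin N → ℝ → E3} {κ : ℝ} {P : ℝ → E3 → ℝ → Fin 4 → ℝ} (hκ0 : 0 < κ) (hκ1 : κ < 1) (hξ : ∀ i, ContDiff ℝ ((⊤ : ℕ∞) : WithTop ℕ∞) (ξ i)) (hcone : ∀ i, ∀ᶠ t in atTop, ‖ξ i t‖ ≤ κ ^ 2 * t) (hsep : ∀ i j, i ≠ j → Tendsto (fun t ↦ ‖ξ i t - ξ j t‖) atTop atTop) (hk : ∃ k : ℝ, 0 ≤ k ∧ k < 1 ∧ ∀ i, ∀ᶠ t in atTop, ‖v i t‖ ≤ k) (hslave :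 ∀ i, Tendsto (fun t ↦ deriv (ξ i) t - v i t) atTop (𝓝 0)) (hW : ∀ δ : ℝ, 0 < δ → δ < 1 → ∃ (C R₀ T : ℝ) (η : ℝ → ℝ), Tendsto η atTop (𝓝 0) ∧ ∀ (t₁ t₂ : ℝ) (c : ℝ → E3) (R : ℝ → ℝ), T ≤ t₁ → t₁ ≤ t₂ → (∀ s ∈ Set.Icc t₁ t₂, ∀ s' ∈ Set.Icc t₁ t₂, ‖c s - c s'‖ ≤ 2 * |s - s'| ∧ |R s - R s'| ≤ 2 * |s - s'|) → (∀ s ∈ Set.Icc t₁ t₂, (R₀ ≤ R s ∧ ‖c s‖ + R s ≤ (κ + κ ^ 2) / 2 * s ∧ ∀ j, ‖ξ j s - c s‖ ≤ (1 - δ) * R s ∨ (1 + δ) * R s ≤ ‖ξ j s - c s‖)) → ∀ μ : Fin 4, |P t₂ (c t₂) (R t₂) μ - P t₁ (c t₁) (R t₁) μ| ≤ C * (∫ s in t₁..t₂, ((R s) ^ 2)⁻¹ + ((R s) ^ (7 / 4 : ℝ))⁻¹) + η t₁) (hI : ∃ (C R₀ T : ℝ) (ζ : ℝ → ℝ), Tendsto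 ζ atTop (𝓝 0) ∧ (∀ (t : ℝ) (i : Fin N) (R : ℝ), T ≤ t → R₀ ≤ R → ‖ξ i t‖ + R ≤ (κ + κ ^ 2) / 2 * t → (∀ j, j ≠ i → 3 * R ≤ ‖ξ i t - ξ j t‖) → |P t (ξ i t) R 0 - M i * (√(1 - ‖v i t‖ ^ 2))⁻¹| ≤ ζ t + C / R ∧ ∀ k : Fin 3, |P t (ξ i t) R k.succ - M i * (√(1 - ‖v i t‖ ^ 2))⁻¹ * v i t k| ≤ ζ t + C / R) ∧ (∀ (t : ℝ) (c : E3) (R : ℝ) (A : Finset (Fin N)) (ρ : Fin N → ℝ), T ≤ t → R₀ ≤ R → ‖c‖ + R ≤ (κ + κ ^ 2) / 2 * t → (∀ j ∈ A, ‖ξ j t - c‖ ≤ R / 2) → (∀ j ∉ A, 2 * R ≤ ‖ξ j t - c‖) → (∀ j ∈ A, R₀ ≤ ρ j ∧ ρ j ≤ R / 4 ∧ ∀ j', j' ≠ j → 3 * ρ j ≤ ‖ξ j t - ξ j' t‖) → ∀ μ : Fin 4, |P t c R μ - ∑ j ∈ A, P t (ξ j t) (ρ j) μ| ≤ C * (R⁻¹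 + ∑ j ∈ A, (ρ j)⁻¹) + ζ t)) (U : Finset (Fin N)) (a : Fin N) (hpair : ∃ p : Fin N × Fin N, p.1 ≠ p.2) {c₂ : ℝ} (hc₂ : 0 < c₂) (hc₂κ : c₂ ≤ (κ - κ ^ 2) / 2) (hc₂1 : c₂ ≤ 1), ∃ (Cw C' ψst Tw : ℝ) (ζ D : ℝ → ℝ), 0 ≤ Cw ∧ 0 ≤ C' ∧ 0 < ψst ∧ Tendsto ζ atTop (𝓝 0) ∧ Tendsto D atTop atTop ∧ (∀ t, Tw ≤ t → 0 ≤ ζ t ∧ 1 ≤ D t) ∧ ∃ ηa : ℝ → ℝ, Tendsto ηa atTop (𝓝 0) ∧ (∀ t, 0 ≤ ηa t) ∧ ∀ (ψ₀ : ℝ), ψst ≤ ψ₀ → ∀ (s₁ s₂ : ℝ) (ψ : ℝ → ℝ), Tw ≤ s₁ → ψ₀ ≤ c₂ * s₁ → s₁ ≤ s₂ → (∀ s ∈ Set.Icc s₁ s₂, ∀ s' ∈ Set.Icc s₁ s₂, |ψ s - ψ s'| ≤ 4 * |s - s'|) → (∀ s ∈ Set.Icc s₁ s₂, ψ₀ ≤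 ψ s ∧ (∀ j ∈ U, 4 * ‖ξ a s - ξ j s‖ ≤ ψ s ∧ 2 * ‖ξ a s - ξ j s‖ ≤ c₂ * s) ∧ ∀ l ∉ U, ψ s ≤ ‖ξ l s - ξ a s‖) → (∀ μ : Fin 4, |P s₂ (ξ a s₂) (min (ψ s₂ / 2) (c₂ * s₂)) μ - P s₁ (ξ a s₁) (min (ψ s₁ / 2) (c₂ * s₁)) μ| ≤ Cw * (∫ s in s₁..s₂, ((min (ψ s / 2) (c₂ * s)) ^ 2)⁻¹ + ((min (ψ s / 2) (c₂ * s)) ^ (7 / 4 : ℝ))⁻¹) + ηa s₁) ∧ (∀ s ∈ Set.Icc s₁ s₂, |P s (ξ a s) (min (ψ s / 2) (c₂ * s)) 0 - ∑ j ∈ U, M j * (√(1 - ‖v j s‖ ^ 2))⁻¹| ≤ (1 + U.card) * ζ s + C' * (2 * (1 + 8 * U.card) / ψ₀ + 6 * U.card / D s) ∧ ∀ k' : Fin 3, |P s (ξ a s) (min (ψ s / 2) (c₂ * s)) k'.succ - ∑ j ∈ U, M j * (√(1 - ‖v j s‖ ^ 2))⁻¹ * v j s k'| ≤ (1 + U.card)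 * ζ s + C' * (2 * (1 + 8 * U.card) / ψ₀ + 6 * U.card / D s)) :=
  @ChargeKinematics.rule_window_law

end Summit.FinalStateConjecture.FinalStateConjecture.Theorems

end
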